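import Literature.Barriers.FinalStateConjecture.KleinGordonRealMode
import Literature.Analysis.SpecialFunctions.SpheroidalHarmonicEigencurve
import Literature.Analysis.SpecialFunctions.SpheroidalHarmonicLegendre
import HarnessLib

/-!
# The real threshold mode with a genuine angular eigenvalue: choice of the constants

Topic `Literature/Barriers/FinalStateConjecture` (namespace `Literature.Barriers.FinalStateConjecture`).
This file feeds the abstract shooting theorem `exists_realMode` (`KleinGordonRealMode.lean`,
Shlapentokh-Rothman, CMP 329 (2014), §4.2 Props. 4.1–4.2) with the angular input of Part A: a
Legendre value `ν_n = n(n + 2m₀ + 1)`, `n` even and LARGE (`SpheroidalHarmonicLegendre.lean`), its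
real eigenvalue branch `ν(κ)` on `κ ∈ [a₁, 0]` (`SpheroidalHarmonicEigencurve.exists_eigenBranch`,
`1`-Lipschitz), and the eigenvalue function `λ(μ) = ν(a²(ω₀² − μ²)) + m₀(m₀ + 1)`; it chooses the
mass window `[μa, μb]` (`μb` by the discriminant condition making `V_{μb} ≥ 0`, `μa` by the Sturm
window condition) and verifies the hypotheses. Output (`exists_threshold_data`): a real mode
`(ω₀, m, λ, μ₀)` — `u = radRe > 0` on `(r₊, ∞)`, exponentially decaying with its derivative in
normal form — with `|ω₀| < μ₀`, `μ₀ − |ω₀| < δ/2`, `μ₀² ≤ (11/10)ω₀²`, and `λ − m₀(m₀+1)` a real zero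
of the angular shooting function at spheroidicity `a²(ω₀² − μ₀²)`. Everything is proved.

## References

* Y. Shlapentokh-Rothman, Comm. Math. Phys. 329 (2014) 859–891, §4.2 (Props. 4.1–4.2), App. B.
  Key `ShlapentokhRothman2014KleinGordon`.
-/

noncomputable section

open Set Filter Topology Complex
open scoped ContDiff

namespace Literature.Barriers.FinalStateConjecture

open Literature.Geometry.Lorentzian Literature.Geometry.Lorentzian.Kerr Literature.Analysis.ODE
  Literature.Analysis.SpecialFunctions

variable {M a : ℝ} {m : ℤ}

/-! ### Elementary inputs -/

/-- `ω₀ ≠ 0` for `a ≠ 0`, `m ≠ 0`. [folklore] -/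
theorem kgOmega0_ne_zero (h : IsSubextremal M a) (ha : a ≠ 0) (hm : m ≠ 0) : kgOmega0 M a m ≠ 0 := by
  have hM := h.pos
  have hr : 0 < rPlus M a := lt_of_le_of_lt h.rMinus_nonneg h.rMinus_lt_rPlus
  unfold kgOmega0
  have : (m : ℝ) ≠ 0 := by exact_mod_cast hm
  positivity

/-- **Non-negativity of the potential from the discriminant condition**:
if `λ̃ ≥ 0`, `μ² > ω₀²` and `(μ² − ω₀²)(λ̃ − ω₀²r₊²) ≥ ω₀⁴r₊²`, then `V_μ ≥ 0` on `(r₊, ∞)`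
(`V ≥ (r − r₊)²(γ²r² − 2ω₀²r₊r + λ̃ − ω₀²r₊²)`, a quadratic with non-positive discriminant).
[cite: ShlapentokhRothman2014KleinGordon, §4.2] -/
theorem kgVre_nonneg_of_discr (h : IsSubextremal M a) {lam μ : ℝ} (hL0 : 0 ≤ kgLamTilde M a m lam)
    (hγ : kgOmega0 M a m ^ 2 < μ ^ 2)
    (hdisc : (kgOmega0 M a m ^ 2) ^ 2 * rPlus M a ^ 2 ≤ (μ ^ 2 - kgOmega0 M a m ^ 2) * (kgLamTilde M a m lam - kgOmega0 M a m ^ 2 * rPlus M a ^ 2)) :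
    ∀ t ∈ Ioi (rPlus M a), 0 ≤ kgVre M a m lam μ t := by
  intro t ht
  set W := kgOmega0 M a m ^ 2 with hW
  set L := kgLamTilde M a m lam with hL
  set g2 := μ ^ 2 - W with hg2
  have hg2p : 0 < g2 := by rw [hg2]; linarith
  have hrp : 0 ≤ rPlus M a := le_trans h.rMinus_nonneg h.rMinus_lt_rPlus.le
  have ht0 : 0 ≤ t := le_trans hrp ht.le
  have hΔ : delta M a t = (t - rPlus M a) * (t - rMinus M a) := delta_eq_mul h.le t
  have ht' : rPlus M a < t := ht
  have h1 : (t - rPlus M a) ^ 2 ≤ delta M a t := by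
    rw [hΔ, sq]
    exact mul_le_mul_of_nonneg_left (by linarith [h.rMinus_lt_rPlus]) (by linarith)
  -- the quadratic is non-negative
  have hquad : 0 ≤ g2 * t ^ 2 - 2 * W * rPlus M a * t + (L - W * rPlus M a ^ 2) := by
    have key : 0 ≤ g2 * (g2 * t ^ 2 - 2 * W * rPlus M a * t + (L - W * rPlus M a ^ 2)) := by
      have : g2 * (g2 * t ^ 2 - 2 * W * rPlus M a * t + (L - W * rPlus M a ^ 2)) =
          (g2 * t - W * rPlus M a) ^ 2 + (g2 * (L - W * rPlus M a ^ 2) - W ^ 2 * rPlus M a ^ 2) := by ring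
      rw [this]
      nlinarith [sq_nonneg (g2 * t - W * rPlus M a), hdisc]
    by_contra hc
    push Not at hc
    have := mul_lt_mul_of_pos_left hc hg2p
    rw [mul_zero] at this
    linarith
  have hLt : 0 ≤ L + μ ^ 2 * t ^ 2 := by positivity
  unfold kgVre
  rw [← hW, ← hL]
  have e : (t ^ 2 - rPlus M a ^ 2) ^ 2 = (t - rPlus M a) ^ 2 * (t + rPlus M a) ^ 2 := by ring
  rw [e]
  have h2 : (t - rPlus M a) ^ 2 * (L + μ ^ 2 * t ^ 2) ≤ delta M a t * (L + μ ^ 2 * t ^ 2) := mul_le_mul_of_nonneg_right h1 hLt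
  have h3 : W * ((t - rPlus M a) ^ 2 * (t + rPlus M a) ^ 2) ≤ (t - rPlus M a) ^ 2 * (L + μ ^ 2 * t ^ 2) := by
    have : (t - rPlus M a) ^ 2 * (L + μ ^ 2 * t ^ 2) - W * ((t - rPlus M a) ^ 2 * (t + rPlus M a) ^ 2) =
        (t - rPlus M a) ^ 2 * (g2 * t ^ 2 - 2 * W * rPlus M a * t + (L - W * rPlus M a ^ 2)) := by rw [hg2]; ring
    nlinarith [mul_nonneg (sq_nonneg (t - rPlus M a)) hquad]
  linarith

/-- The Legendre base zero of the real shooting function: `F_ℝ(ν_n, 0) = 0` for `n` even. [cite: ShlapentokhRothman2014KleinGordon, App. B] -/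
theorem shootRe_legendre (m₀ : ℕ) {n : ℕ} (hn : Even n) : shootRe m₀ ((n : ℝ) * ((n : ℝ) + 2 * m₀ + 1), 0) = 0 := by
  have h0 := sphmDer_one_eq_zero_of_even m₀ hn
  unfold shootRe
  simp only
  have e : (((n : ℝ) * ((n : ℝ) + 2 * m₀ + 1) : ℝ) : ℂ) = legNu m₀ n := by unfold legNu; push_cast; ring
  rw [e, Complex.ofReal_zero, h0, Complex.zero_re]

/-! ### The threshold data -/

set_option maxHeartbeats 400000 in
/-- **The real threshold mode with a genuine angular eigenvalue.** For sub-extremal `(M, a)`,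
`a ≠ 0`, `m ≠ 0` and `δ > 0` there are `λ, μ₀` and decay data `C, k, S₁` such that:
`|ω₀| < μ₀`, `μ₀ − |ω₀| < δ/2`, `μ₀² ≤ (11/10)ω₀²`; `λ − m₀(m₀+1)` is a real zero of the angular
shooting function at `κ₀ = a²(ω₀² − μ₀²)`; the horizon-regular threshold solution
`u = radRe(λ, μ₀)` is positive on `(r₊, ∞)`; and `√Δ u`, `(√Δ u)'` decay like `e^{−kt}` beyond
`S₁ > r₊`. [cite: ShlapentokhRothman2014KleinGordon, §4.2 Prop. 4.2] -/
theorem exists_threshold_data (h : IsSubextremal M a) (ha : a ≠ 0) (hm : m ≠ 0) {δ : ℝ} (hδ : 0 < δ) :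
    ∃ lam μ₀ C k S₁ : ℝ, |kgOmega0 M a m| < μ₀ ∧ μ₀ - |kgOmega0 M a m| < δ / 2 ∧ μ₀ ^ 2 ≤ 11 / 10 * kgOmega0 M a m ^ 2 ∧
      shootRe m.natAbs (lam - (m.natAbs : ℝ) * ((m.natAbs : ℝ) + 1), a ^ 2 * (kgOmega0 M a m ^ 2 - μ₀ ^ 2)) = 0 ∧
      (∀ t ∈ Ioi (rPlus M a), 0 < radRe h m lam μ₀ t) ∧ 0 < k ∧ rPlus M a < S₁ ∧
      ∀ t : ℝ, S₁ ≤ t → |radV h m lam μ₀ t| ≤ C * Real.exp (-(k * t)) ∧ |radV' h m lam μ₀ t| ≤ C * Real.exp (-(k * t)) := by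
  have hM := h.pos
  have hrp : 0 < rPlus M a := lt_of_le_of_lt h.rMinus_nonneg h.rMinus_lt_rPlus
  have hw0 : kgOmega0 M a m ≠ 0 := kgOmega0_ne_zero h ha hm
  have hWp : 0 < kgOmega0 M a m ^ 2 := by positivity
  have hω0p : 0 < |(kgOmega0 M a m)| := abs_pos.2 hw0
  set m₀ : ℕ := m.natAbs with hm₀
  set cm : ℝ := (m₀ : ℝ) * ((m₀ : ℝ) + 1) with hcm
  have hcm0 : 0 ≤ cm := by rw [hcm]; positivity
  have ha2 : 0 < a ^ 2 := lt_of_le_of_ne (sq_nonneg a) (Ne.symm (pow_ne_zero 2 ha))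
  ------------------------------------------------------------------
  -- the Legendre index
  ------------------------------------------------------------------
  set Nreq : ℝ := 4 * M * rPlus M a * (kgOmega0 M a m ^ 2) + 11 * (kgOmega0 M a m ^ 2) * rPlus M a ^ 2 + 2 * |(kgOmega0 M a m)| ^ 3 * rPlus M a ^ 2 / δ + 1 with hNreq
  set n : ℕ := 2 * ⌈Nreq⌉₊ with hn
  have hn_even : Even n := ⟨⌈Nreq⌉₊, by rw [hn]; ring⟩
  set νb : ℝ := (n : ℝ) * ((n : ℝ) + 2 * m₀ + 1) with hνb
  have hνb_ge : Nreq ≤ νb := by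
    have h1 : Nreq ≤ (⌈Nreq⌉₊ : ℝ) := Nat.le_ceil _
    have h2 : ((⌈Nreq⌉₊ : ℕ) : ℝ) ≤ (n : ℝ) := by rw [hn]; push_cast; linarith [Nat.cast_nonneg (α := ℝ) ⌈Nreq⌉₊]
    have h3 : (n : ℝ) ≤ νb := by
      rw [hνb]
      have : (1 : ℝ) ≤ (n : ℝ) + 2 * m₀ + 1 := by
        have h1 := Nat.cast_nonneg (α := ℝ) n; have h2 := Nat.cast_nonneg (α := ℝ) m₀; linarith
      have h4 := mul_le_mul_of_nonneg_left this (Nat.cast_nonneg (α := ℝ) n)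
      linarith
    linarith
  have hb : shootRe m₀ (νb, 0) = 0 := shootRe_legendre m₀ hn_even
  ------------------------------------------------------------------
  -- the real branch on `[a₁, 0]`
  ------------------------------------------------------------------
  set a₁ : ℝ := -(a ^ 2 * (kgOmega0 M a m ^ 2)) - 1 with ha₁
  have haW : 0 ≤ a ^ 2 * (kgOmega0 M a m ^ 2) := mul_nonneg ha2.le hWp.le
  have ha₁0 : a₁ < 0 := by rw [ha₁]; linarith
  obtain ⟨ν, hν⟩ := exists_eigenBranch (m := m₀) (νb := νb) hb ha₁0
  obtain ⟨κf, hκf⟩ : ∃ f : ℝ → ℝ, f = fun μ ↦ a ^ 2 * ((kgOmega0 M a m ^ 2) - μ ^ 2) := ⟨_, rfl⟩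
  obtain ⟨lamf, hlamf⟩ : ∃ f : ℝ → ℝ, f = fun μ ↦ ν (κf μ) + cm := ⟨_, rfl⟩
  ------------------------------------------------------------------
  -- the bounds `L₁ ≤ λ̃ ≤ Lmax` and the window
  ------------------------------------------------------------------
  set L₁ : ℝ := νb - a ^ 2 * (kgOmega0 M a m ^ 2) / 10 + cm + a ^ 2 * (kgOmega0 M a m ^ 2) - 4 * M * rPlus M a * (kgOmega0 M a m ^ 2) with hL₁
  set Lmax : ℝ := νb + a ^ 2 * (kgOmega0 M a m ^ 2) / 10 + cm + a ^ 2 * (kgOmega0 M a m ^ 2) - 4 * M * rPlus M a * (kgOmega0 M a m ^ 2) with hLmax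
  have hL₁ge : 11 * (kgOmega0 M a m ^ 2) * rPlus M a ^ 2 + 2 * |(kgOmega0 M a m)| ^ 3 * rPlus M a ^ 2 / δ + 1 ≤ L₁ := by
    rw [hL₁]; linarith [hνb_ge, hcm0, haW]
  have hL₁W : 10 * (kgOmega0 M a m ^ 2) * rPlus M a ^ 2 + 2 * |(kgOmega0 M a m)| ^ 3 * rPlus M a ^ 2 / δ + 1 ≤ L₁ - (kgOmega0 M a m ^ 2) * rPlus M a ^ 2 := by linarith
  have hgap : 0 < L₁ - (kgOmega0 M a m ^ 2) * rPlus M a ^ 2 := by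
    have : 0 ≤ 10 * (kgOmega0 M a m ^ 2) * rPlus M a ^ 2 + 2 * |(kgOmega0 M a m)| ^ 3 * rPlus M a ^ 2 / δ := by positivity
    linarith
  have hL₁0 : 0 ≤ L₁ := by
    have : 0 ≤ (kgOmega0 M a m ^ 2) * rPlus M a ^ 2 := by positivity
    linarith
  set D : ℝ := (kgOmega0 M a m ^ 2) ^ 2 * rPlus M a ^ 2 / (L₁ - (kgOmega0 M a m ^ 2) * rPlus M a ^ 2) with hD
  have hDp : 0 < D := by rw [hD]; positivity
  have hD10 : D ≤ (kgOmega0 M a m ^ 2) / 10 := by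
    rw [hD, div_le_iff₀ hgap]
    have h0 : 0 ≤ 2 * |(kgOmega0 M a m)| ^ 3 * rPlus M a ^ 2 / δ := by positivity
    have h1 : 10 * (kgOmega0 M a m ^ 2) * rPlus M a ^ 2 ≤ L₁ - (kgOmega0 M a m ^ 2) * rPlus M a ^ 2 := by linarith
    have h2 := mul_le_mul_of_nonneg_left h1 (by positivity : (0 : ℝ) ≤ (kgOmega0 M a m ^ 2) / 10)
    have e : (kgOmega0 M a m ^ 2) / 10 * (10 * (kgOmega0 M a m ^ 2) * rPlus M a ^ 2) = (kgOmega0 M a m ^ 2) ^ 2 * rPlus M a ^ 2 := by ring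
    linarith
  have hDδ : D < |(kgOmega0 M a m)| * δ / 2 := by
    rw [hD, div_lt_iff₀ hgap]
    have hW3 : (kgOmega0 M a m ^ 2) ^ 2 = |(kgOmega0 M a m)| ^ 3 * |(kgOmega0 M a m)| := by
      rw [show (kgOmega0 M a m) ^ 2 = |(kgOmega0 M a m)| ^ 2 by rw [sq_abs]]; ring
    have h1 : |(kgOmega0 M a m)| * δ / 2 * (2 * |(kgOmega0 M a m)| ^ 3 * rPlus M a ^ 2 / δ) = |(kgOmega0 M a m)| ^ 3 * |(kgOmega0 M a m)| * rPlus M a ^ 2 := by field_simp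
    have h2 : 2 * |(kgOmega0 M a m)| ^ 3 * rPlus M a ^ 2 / δ < L₁ - (kgOmega0 M a m ^ 2) * rPlus M a ^ 2 := by
      have : 0 ≤ 10 * (kgOmega0 M a m ^ 2) * rPlus M a ^ 2 := by positivity
      linarith
    calc (kgOmega0 M a m ^ 2) ^ 2 * rPlus M a ^ 2 = |(kgOmega0 M a m)| * δ / 2 * (2 * |(kgOmega0 M a m)| ^ 3 * rPlus M a ^ 2 / δ) := by rw [h1, hW3]
      _ < |(kgOmega0 M a m)| * δ / 2 * (L₁ - (kgOmega0 M a m ^ 2) * rPlus M a ^ 2) := mul_lt_mul_of_pos_left h2 (by positivity)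
  set A := kgWindowA M a m Lmax with hA
  have hAp : 0 < A := lt_of_lt_of_le (by positivity : (0 : ℝ) < 20 * (rPlus M a + M)) (le_max_left _ _)
  set d : ℝ := min (M * kgOmega0 M a m ^ 2 / (5 * A)) (D / 2) with hd
  have hdp : 0 < d := lt_min (by positivity) (by positivity)
  have hdD : d < D := lt_of_le_of_lt (min_le_right _ _) (by linarith)
  set μa : ℝ := Real.sqrt ((kgOmega0 M a m ^ 2) + d) with hμa
  set μb : ℝ := Real.sqrt ((kgOmega0 M a m ^ 2) + D) with hμb
  have hμa2 : μa ^ 2 = (kgOmega0 M a m ^ 2) + d := Real.sq_sqrt (by positivity)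
  have hμb2 : μb ^ 2 = (kgOmega0 M a m ^ 2) + D := Real.sq_sqrt (by positivity)
  have hμa0 : 0 < μa := Real.sqrt_pos.2 (by positivity)
  have hμb0 : 0 < μb := Real.sqrt_pos.2 (by positivity)
  have hab : μa < μb := by rw [hμa, hμb]; exact Real.sqrt_lt_sqrt (by positivity) (by linarith)
  -- `κ(μ) ∈ [a₁, 0]` and the eigenvalue bounds on `[μa, μb]`
  have hκI : ∀ μ ∈ Icc μa μb, κf μ ∈ Icc a₁ 0 ∧ |κf μ| ≤ a ^ 2 * (kgOmega0 M a m ^ 2) / 10 := by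
    intro μ hμ
    have hμ2 : (kgOmega0 M a m ^ 2) + d ≤ μ ^ 2 ∧ μ ^ 2 ≤ (kgOmega0 M a m ^ 2) + D := by
      constructor
      · rw [← hμa2]; exact pow_le_pow_left₀ hμa0.le hμ.1 2
      · rw [← hμb2]; exact pow_le_pow_left₀ (hμa0.le.trans hμ.1) hμ.2 2
    have hk : κf μ = a ^ 2 * ((kgOmega0 M a m ^ 2) - μ ^ 2) := by rw [hκf]
    have hkle : κf μ ≤ 0 := by
      rw [hk]
      have := mul_nonneg ha2.le (show 0 ≤ μ ^ 2 - (kgOmega0 M a m ^ 2) by linarith [hμ2.1, hdp.le])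
      linarith
    have hkge : -(a ^ 2 * D) ≤ κf μ := by
      rw [hk]
      have := mul_le_mul_of_nonneg_left hμ2.2 ha2.le
      linarith
    have haD : a ^ 2 * D ≤ a ^ 2 * ((kgOmega0 M a m ^ 2) / 10) := mul_le_mul_of_nonneg_left hD10 ha2.le
    refine ⟨⟨?_, hkle⟩, ?_⟩
    · rw [ha₁]; linarith
    · rw [abs_of_nonpos hkle]; linarith
  have hLam : ∀ μ ∈ Icc μa μb, L₁ ≤ kgLamTilde M a m (lamf μ) ∧ kgLamTilde M a m (lamf μ) ≤ Lmax := by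
    intro μ hμ
    obtain ⟨hkI, hkabs⟩ := hκI μ hμ
    have hlip := hν.lip (κf μ) hkI 0 ⟨ha₁0.le, le_rfl⟩
    rw [hν.base, sub_zero] at hlip
    have hb1 := (abs_le.1 (hlip.trans hkabs))
    have hlam : lamf μ = ν (κf μ) + cm := by rw [hlamf]
    rw [kgLamTilde, hlam, hL₁, hLmax]
    constructor <;> linarith [hb1.1, hb1.2]
  ------------------------------------------------------------------
  -- the hypotheses of `exists_realMode`
  ------------------------------------------------------------------
  have hcont : ContinuousOn lamf (Icc μa μb) := by
    have hκc : Continuous κf := by rw [hκf]; fun_prop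
    have h1 : ContinuousOn (fun μ ↦ ν (κf μ)) (Icc μa μb) := hν.cont.comp hκc.continuousOn fun μ hμ ↦ (hκI μ hμ).1
    rw [hlamf]
    exact h1.add continuousOn_const
  have hL0 : ∀ μ ∈ Icc μa μb, 0 ≤ kgLamTilde M a m (lamf μ) := fun μ hμ ↦ hL₁0.trans (hLam μ hμ).1
  have hLmaxb : ∀ μ ∈ Icc μa μb, kgLamTilde M a m (lamf μ) ≤ Lmax := fun μ hμ ↦ (hLam μ hμ).2
  have hγ : kgOmega0 M a m ^ 2 < μa ^ 2 := by rw [hμa2]; linarith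
  have hμbW : μb ^ 2 ≤ 11 / 10 * kgOmega0 M a m ^ 2 := by rw [hμb2]; linarith
  have hsmall : μa ^ 2 - kgOmega0 M a m ^ 2 ≤ M * kgOmega0 M a m ^ 2 / (5 * kgWindowA M a m Lmax) := by
    rw [hμa2, ← hA]; have := min_le_left (M * kgOmega0 M a m ^ 2 / (5 * A)) (D / 2) ; linarith
  have hVb : ∀ t ∈ Ioi (rPlus M a), 0 ≤ kgVre M a m (lamf μb) μb t := by
    have hμbI : μb ∈ Icc μa μb := ⟨hab.le, le_rfl⟩
    refine kgVre_nonneg_of_discr h (hL0 μb hμbI) (by rw [hμb2]; linarith) ?_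
    rw [hμb2]
    have hL := (hLam μb hμbI).1
    have e : ((kgOmega0 M a m ^ 2) + D - (kgOmega0 M a m ^ 2)) * (L₁ - (kgOmega0 M a m ^ 2) * rPlus M a ^ 2) = (kgOmega0 M a m ^ 2) ^ 2 * rPlus M a ^ 2 := by
      rw [add_sub_cancel_left, hD]; field_simp
    calc (kgOmega0 M a m ^ 2) ^ 2 * rPlus M a ^ 2 = ((kgOmega0 M a m ^ 2) + D - (kgOmega0 M a m ^ 2)) * (L₁ - (kgOmega0 M a m ^ 2) * rPlus M a ^ 2) := e.symm
      _ ≤ ((kgOmega0 M a m ^ 2) + D - (kgOmega0 M a m ^ 2)) * (kgLamTilde M a m (lamf μb) - (kgOmega0 M a m ^ 2) * rPlus M a ^ 2) := by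
          apply mul_le_mul_of_nonneg_left _ (by linarith)
          linarith
  ------------------------------------------------------------------
  -- the real mode
  ------------------------------------------------------------------
  obtain ⟨μ₀, hμ₀, hpos, -, C, hdec⟩ := exists_realMode h lamf hw0 hab hμa0 hcont hL0 hLmaxb hγ hμbW hsmall hVb
  set k : ℝ := Real.sqrt ((μa ^ 2 - kgOmega0 M a m ^ 2) / 2) with hk
  have hkp : 0 < k := Real.sqrt_pos.2 (by linarith)
  set S₁ : ℝ := kgTailS M a m μa + 1 with hS₁
  have hS₁p : rPlus M a < S₁ := by
    have : 20 * (rPlus M a + M) ≤ kgTailS M a m μa := le_trans (le_max_left _ _) (le_max_left _ _)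
    rw [hS₁]; linarith [hrp, hM]
  refine ⟨lamf μ₀, μ₀, C, k, S₁, ?_, ?_, ?_, ?_, hpos, hkp, hS₁p, fun t ht ↦ hdec t (by rw [hS₁] at ht; exact ht)⟩
  · -- `|ω₀| < μ₀`
    have h1 : (kgOmega0 M a m ^ 2) + d ≤ μ₀ ^ 2 := by rw [← hμa2]; exact pow_le_pow_left₀ hμa0.le hμ₀.1 2
    have hμ00 : 0 < μ₀ := lt_of_lt_of_le hμa0 hμ₀.1
    exact abs_lt_of_sq_lt_sq (by linarith) hμ00.le
  · -- `μ₀ − |ω₀| < δ/2`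
    have h1 : μ₀ ≤ μb := hμ₀.2
    have h2 : μb - |(kgOmega0 M a m)| < δ / 2 := by
      have hsum : 0 < μb + |(kgOmega0 M a m)| := by positivity
      have e : μb - |(kgOmega0 M a m)| = (μb ^ 2 - |(kgOmega0 M a m)| ^ 2) / (μb + |(kgOmega0 M a m)|) := by field_simp; ring
      rw [e, hμb2, sq_abs, div_lt_iff₀ hsum]
      have hpos2 : 0 ≤ δ / 2 * μb := by positivity
      have e2 : (kgOmega0 M a m ^ 2) + D - kgOmega0 M a m ^ 2 = D := by ring
      rw [e2]
      linarith [hDδ]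
    linarith
  · -- `μ₀² ≤ (11/10)(kgOmega0 M a m)²`
    have : μ₀ ^ 2 ≤ μb ^ 2 := pow_le_pow_left₀ (hμa0.le.trans hμ₀.1) hμ₀.2 2
    linarith
  · -- the shooting zero
    have hz := hν.zero (κf μ₀) (hκI μ₀ hμ₀).1
    have e1 : lamf μ₀ - (m.natAbs : ℝ) * ((m.natAbs : ℝ) + 1) = ν (κf μ₀) := by simp only [hlamf, hcm, hm₀]; ring
    rw [e1]
    have hk : κf μ₀ = a ^ 2 * (kgOmega0 M a m ^ 2 - μ₀ ^ 2) := by rw [hκf]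
    rw [← hk]
    exact hz

end Literature.Barriers.FinalStateConjecture

end
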